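import Summits.CriticalPhenomena.SAWScalingLimit.Theorems.SAWCompassLatticeCompassSLEYbCompactContainer
import Summits.CriticalPhenomena.SAWScalingLimit.Theorems.SAWCompassLatticeCompassSLEYbCriterion
import Summits.CriticalPhenomena.SAWScalingLimit.Theorems.SAWDevelopingMapHexTransferDictionaryGlue
import Summits.CriticalPhenomena.SAWScalingLimit.Theorems.ObservableToSLE.Negative.TightnessNecessity
import Summits.CriticalPhenomena.SAWScalingLimit.Theorems.ShellCrossingBound.Negative.OfEventualTight
import Literature.Probability.RandomPlanarGeometry.SLEConvergenceCriterion
import Literature.Probability.RandomPlanarGeometry.LocalMartingaleProofs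
import Literature.Probability.RandomPlanarGeometry.CurveTightness

/-!
# Stub T1 of the `CompassSLE` skeleton is NECESSARY (crux stmt-CriticalPhenomena-6965, line `registered`,
# lead c2): Le Cam along the mesh for Glazman–Manolescu's `π/2` Yang–Baxter walk

Honesty certificate for the registered skeleton `Cruxes/CompassSLE/Lines/birth.lean` (v4): its open stub
T1 `stub_ybTraversalBound` (Aizenman–Burchard multi-traversal bound, SHELL-DEPENDENT threshold) is a
CONSEQUENCE of the crux (`CompassSLE ↔ YBSquareSLE`, p143456), so promoting it is summit-safe. Port of
`ObservableToSLE/Negative/TightnessNecessity.lean` (`δℍ`) and `ShellCrossingBound/Negative/OfEventualTight.lean`: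

* `isTightAlongMesh_yb_of_tendsto` — **Le Cam along the mesh**: weak convergence of the pushed laws
  `ybLaw (π/2) D.carrier δ 1 (a δ) (b δ) ∘ (curve δ)⁻¹` along `𝓝[>] 0` to SOME probability measure
  forces `IsTightAlongMesh` (not soft along the uncountable filter: Ulam tightness of the limit, one
  Urysohn function per scale, the COMPACT CONTAINER `exists_isCompact_forall_ybCurve_mem` for meshes
  bounded below, a closed totally bounded diagonal intersection); `ybTight_of_convergesInLawToSLE`.
* `exists_isTightMeasureSet_image_yb` — tightness along the mesh ⇒ SET-tightness of the pushed laws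
  over an initial mesh interval `(0, δ₀]` (the container catches the meshes above the threshold).
* `ybTraversalBound_of_isTightMeasureSet_image` — set-tightness ⇒ the T1 shape with `K = 1`, `λ = 3`
  and the shell-dependent threshold of `exists_forall_not_hasTraversals_of_isCompact`.
* certificates `ybTraversalBound_of_convergesInLawToSLE`, `ybTraversalBound_of_ybSquareSLE`
  (`YBSquareSLE →` registered signature of `stub_ybTraversalBound`, verbatim), `ybTight_of_ybSquareSLE`.

So T1 ⇔ T ⇔ the T-half of the crux. No named fact is used. References: Billingsley, *Convergence of
Probability Measures* (1999), Thms 5.1–5.2 [BillingsleyCPM1999]; Aizenman–Burchard, Duke Math. J. 99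
(1999) [AizenmanBurchardDuke1999]; Glazman–Manolescu (2020) [GlazmanManolescu2019].
-/

noncomputable section

namespace Summit.CriticalPhenomena.SAWScalingLimit.Theorems.SAWCompassLatticeCompassSLE

open MeasureTheory Filter Topology Set
open scoped NNReal ENNReal BoundedContinuousFunction
open Literature.Probability.RandomPlanarGeometry
open Literature.Probability.RandomPlanarGeometry.SAW.YangBaxter
open Summit.CriticalPhenomena.SAWScalingLimit.Theses
open Summit.CriticalPhenomena.SAWScalingLimit.Theorems.ObservableToSLE.Negative
  (exists_urysohn_infDist integral_urysohn_le measureReal_preimage_le_integral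
    le_infDist_of_not_mem_thickening)
open Summit.CriticalPhenomena.SAWScalingLimit.Theorems.ShellCrossingBound.Negative
  (exists_forall_not_hasTraversals_of_isCompact)

open Summit.CriticalPhenomena.SAWScalingLimit.Cruxes.HexTransfer.YbRelay
  (eventually_ne_of_isYBEndpointApprox)

/-! ### Le Cam along the mesh -/

/-- **LE CAM ALONG THE MESH for GM's `π/2` Yang–Baxter walk.** If the pushed-forward curve laws of
`ybLaw (π/2) D.carrier δ 1 (a δ) (b δ)` converge weakly along `𝓝[>] 0` to a probability measure `μ` on
`CurveClass ℂ`, the family is tight along the mesh: the laws are probability measures eventually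
(`eventually_isProbabilityMeasure_ybLaw`) with `a δ ≠ b δ` (`eventually_ne_of_isYBEndpointApprox`);
Ulam tightness of `μ`; one Urysohn function per scale `1/(k+1)`; for meshes bounded below ALL curve
classes lie in one compact set (`exists_isCompact_forall_ybCurve_mem`); a closed totally bounded
diagonal intersection. Port of `ObservableToSLE.Negative.isTightAlongMesh_of_convergesInLawToSLE`. -/
theorem isTightAlongMesh_yb_of_tendsto {D : DobrushinDomain} {a b : ℝ → MidEdge}
    (hab : IsYBEndpointApprox (fun (_ : ℤ) => Real.pi / 2) D a b)
    {μ : Measure (CurveClass ℂ)} [IsProbabilityMeasure μ]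
    (hlim : ∀ f : BoundedContinuousFunction (CurveClass ℂ) ℝ,
      Tendsto (fun δ => ∫ γ, f (γ.curve (fun (_ : ℤ) => Real.pi / 2) δ)
          ∂(ybLaw (fun (_ : ℤ) => Real.pi / 2) D.carrier δ 1 (a δ) (b δ)))
        (𝓝[>] (0 : ℝ)) (𝓝 (∫ x, f x ∂μ))) :
    IsTightAlongMesh
      (fun δ (γ : YangBaxterSAW (fun (_ : ℤ) => Real.pi / 2) D.carrier δ (a δ) (b δ)) =>
        γ.curve (fun (_ : ℤ) => Real.pi / 2) δ)
      (fun δ => ybLaw (fun (_ : ℤ) => Real.pi / 2) D.carrier δ 1 (a δ) (b δ)) := by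
  -- adapted from `ObservableToSLE.Negative.isTightAlongMesh_of_convergesInLawToSLE`
  classical
  set Θ : ℤ → ℝ := fun _ => Real.pi / 2 with hΘ
  -- good meshes: probability laws and distinct endpoints
  have hgood : ∀ᶠ δ in 𝓝[>] (0 : ℝ),
      IsProbabilityMeasure (ybLaw Θ D.carrier δ 1 (a δ) (b δ)) ∧ a δ ≠ b δ :=
    (eventually_isProbabilityMeasure_ybLaw D hab).and (eventually_ne_of_isYBEndpointApprox hab)
  intro ε hε
  rcases eq_or_ne ε ⊤ with rfl | hεtop
  · exact ⟨∅, isCompact_empty, Eventually.of_forall fun δ => le_top⟩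
  set e : ℝ := ε.toReal with he
  have he0 : 0 < e := ENNReal.toReal_pos hε.ne' hεtop
  -- per-level data: compact K_k (nonempty), threshold τ_k
  have hlevel : ∀ k : ℕ, ∃ K : Set (CurveClass ℂ), IsCompact K ∧ K.Nonempty ∧ ∃ τ : ℝ, 0 < τ ∧
      ∀ δ ∈ Set.Ioo (0 : ℝ) τ,
        (IsProbabilityMeasure (ybLaw Θ D.carrier δ 1 (a δ) (b δ)) ∧ a δ ≠ b δ) ∧
        ybLaw Θ D.carrier δ 1 (a δ) (b δ)
            ((fun γ : YangBaxterSAW Θ D.carrier δ (a δ) (b δ) => γ.curve Θ δ) ⁻¹'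
              (Metric.thickening (1 / ((k : ℝ) + 1)) K)ᶜ) ≤ ENNReal.ofReal (e / 2 / 2 ^ k) := by
    intro k
    set ek : ℝ := e / 2 / 2 ^ k with hek_def
    have hek : 0 < ek := by positivity
    obtain ⟨K0, hK0c, hK0⟩ := (isTightMeasureSet_iff_exists_isCompact_measure_compl_le.1
      (isTightMeasureSet_singleton (μ := μ))) (ENNReal.ofReal (ek / 2))
      (ENNReal.ofReal_pos.2 (by positivity))
    have hμK0 : μ K0ᶜ ≤ ENNReal.ofReal (ek / 2) := hK0 μ rfl
    set c₀ : CurveClass ℂ := CurveClass.mk (Curve.const 0)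
    set K1 : Set (CurveClass ℂ) := insert c₀ K0 with hK1
    have hK1c : IsCompact K1 := hK0c.insert c₀
    have hK1ne : K1.Nonempty := ⟨c₀, Set.mem_insert _ _⟩
    have hμK1 : μ K1ᶜ ≤ ENNReal.ofReal (ek / 2) :=
      (measure_mono (Set.compl_subset_compl.2 (Set.subset_insert _ _))).trans hμK0
    have hη : (0 : ℝ) < 1 / ((k : ℝ) + 1) := by positivity
    obtain ⟨g, hg0, hg1, hgK, hgF⟩ := exists_urysohn_infDist K1 hη
    have hlt : ∫ x, g x ∂μ < ek := by
      refine (integral_urysohn_le hK1c.isClosed hg1 hgK).trans_lt ?_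
      rw [measureReal_def]
      have : (μ K1ᶜ).toReal ≤ ek / 2 := ENNReal.toReal_le_of_le_ofReal (by positivity) hμK1
      linarith
    have hev : ∀ᶠ δ in 𝓝[>] (0 : ℝ),
        ∫ γ, g ((fun γ : YangBaxterSAW Θ D.carrier δ (a δ) (b δ) => γ.curve Θ δ) γ)
          ∂ybLaw Θ D.carrier δ 1 (a δ) (b δ) < ek :=
      (hlim g).eventually (Iio_mem_nhds hlt)
    obtain ⟨τ, hτ, hτsub⟩ := mem_nhdsGT_iff_exists_Ioo_subset.1 (hev.and hgood)
    refine ⟨K1, hK1c, hK1ne, τ, hτ, fun δ hδ => ?_⟩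
    obtain ⟨hint, hg'⟩ := hτsub hδ
    refine ⟨hg', ?_⟩
    haveI := hg'.1
    have hF : MeasurableSet (Metric.thickening (1 / ((k : ℝ) + 1)) K1)ᶜ :=
      Metric.isOpen_thickening.measurableSet.compl
    have h1 : (ybLaw Θ D.carrier δ 1 (a δ) (b δ)).real
        ((fun γ : YangBaxterSAW Θ D.carrier δ (a δ) (b δ) => γ.curve Θ δ) ⁻¹'
          (Metric.thickening (1 / ((k : ℝ) + 1)) K1)ᶜ) ≤
        ∫ γ, g ((fun γ : YangBaxterSAW Θ D.carrier δ (a δ) (b δ) => γ.curve Θ δ) γ)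
          ∂ybLaw Θ D.carrier δ 1 (a δ) (b δ) :=
      measureReal_preimage_le_integral (YBWalk.measurable_of_top _) hF hg0
        fun x hx => hgF x (le_infDist_of_not_mem_thickening hK1ne hx)
    calc ybLaw Θ D.carrier δ 1 (a δ) (b δ)
          ((fun γ : YangBaxterSAW Θ D.carrier δ (a δ) (b δ) => γ.curve Θ δ) ⁻¹'
            (Metric.thickening (1 / ((k : ℝ) + 1)) K1)ᶜ)
        = ENNReal.ofReal ((ybLaw Θ D.carrier δ 1 (a δ) (b δ)).real
            ((fun γ : YangBaxterSAW Θ D.carrier δ (a δ) (b δ) => γ.curve Θ δ) ⁻¹'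
              (Metric.thickening (1 / ((k : ℝ) + 1)) K1)ᶜ)) :=
          (ENNReal.ofReal_toReal (measure_ne_top _ _)).symm
      _ ≤ ENNReal.ofReal ek := ENNReal.ofReal_le_ofReal (h1.trans hint.le)
  choose K hKc hKne τ hτ hKτ using hlevel
  -- antitone positive thresholds `σ k = min_{j ≤ k} τ j`
  set σ : ℕ → ℝ := fun k =>
    (Finset.range (k + 1)).inf' (Finset.nonempty_range_iff.2 (Nat.succ_ne_zero k)) τ with hσ
  have hσle : ∀ k, σ k ≤ τ k := fun k =>
    Finset.inf'_le _ (Finset.mem_range.2 (Nat.lt_succ_self k))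
  have hσpos : ∀ k, 0 < σ k := fun k => (Finset.lt_inf'_iff _).2 fun j _ => hτ j
  have hσanti : ∀ k, σ (k + 1) ≤ σ k := fun k =>
    (Finset.le_inf'_iff _ _).2 fun j hj =>
      Finset.inf'_le _ (Finset.mem_range.2 ((Finset.mem_range.1 hj).trans (Nat.lt_succ_self _)))
  -- compact containers for meshes in `[σ (k+1), σ 0]`
  have hC : ∀ k, ∃ C : Set (CurveClass ℂ), IsCompact C ∧ ∀ δ ∈ Set.Icc (σ (k + 1)) (σ 0),
      ∀ u v : MidEdge, u ≠ v → ∀ γ : YangBaxterSAW Θ D.carrier δ u v, γ.curve Θ δ ∈ C := fun k =>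
    exists_isCompact_forall_ybCurve_mem D.carrier D.isBounded (σ (k + 1)) (σ 0) (hσpos (k + 1))
  choose C hCc hCmem using hC
  set η : ℕ → ℝ := fun k => 1 / ((k : ℝ) + 1) with hη
  have hηpos : ∀ k, 0 < η k := fun k => by positivity
  set A : ℕ → Set (CurveClass ℂ) := fun k => Metric.cthickening (η k) (K k) ∪ C k with hA
  set Kf : Set (CurveClass ℂ) := ⋂ k, A k with hKf
  have hKf_closed : IsClosed Kf :=
    isClosed_iInter fun k => Metric.isClosed_cthickening.union (hCc k).isClosed
  have hKf_tb : TotallyBounded Kf := by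
    refine Metric.totallyBounded_iff.2 fun r hr => ?_
    obtain ⟨k, hk⟩ := exists_nat_gt (3 / r)
    have hηk : 3 * η k < r := by
      have h3 : 3 < r * k := by rwa [div_lt_iff₀ hr, mul_comm] at hk
      have hk0 : (0 : ℝ) < k := by
        by_contra h0
        have : (k : ℝ) ≤ 0 := not_lt.1 h0
        nlinarith
      show 3 * (1 / ((k : ℝ) + 1)) < r
      rw [mul_one_div, div_lt_iff₀ (by positivity)]
      nlinarith
    obtain ⟨t, htfin, htcov⟩ :=
      Metric.totallyBounded_iff.1 ((hKc k).union (hCc k)).totallyBounded (η k) (hηpos k)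
    refine ⟨t, htfin, fun x hx => ?_⟩
    have hxA : x ∈ A k := Set.mem_iInter.1 hx k
    rcases hxA with hx1 | hx2
    · have hx1' : x ∈ Metric.thickening (2 * η k) (K k) :=
        Metric.cthickening_subset_thickening' (by linarith [hηpos k]) (by linarith [hηpos k]) _ hx1
      obtain ⟨z, hz, hxz⟩ := Metric.mem_thickening_iff.1 hx1'
      obtain ⟨y, hy, hzy⟩ := Set.mem_iUnion₂.1 (htcov (Or.inl hz))
      refine Set.mem_iUnion₂.2 ⟨y, hy, ?_⟩
      rw [Metric.mem_ball] at hzy ⊢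
      calc dist x y ≤ dist x z + dist z y := dist_triangle _ _ _
        _ < 2 * η k + η k := add_lt_add hxz hzy
        _ = 3 * η k := by ring
        _ < r := hηk
    · obtain ⟨y, hy, hxy⟩ := Set.mem_iUnion₂.1 (htcov (Or.inr hx2))
      refine Set.mem_iUnion₂.2 ⟨y, hy, ?_⟩
      rw [Metric.mem_ball] at hxy ⊢
      have : η k < r := by linarith [hηpos k]
      exact hxy.trans this
  have hKf_compact : IsCompact Kf :=
    isCompact_iff_totallyBounded_isComplete.2 ⟨hKf_tb, hKf_closed.isComplete⟩
  refine ⟨Kf, hKf_compact, ?_⟩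
  filter_upwards [Ioo_mem_nhdsGT (hσpos 0)] with δ hδ
  have hpre : (fun γ : YangBaxterSAW Θ D.carrier δ (a δ) (b δ) => γ.curve Θ δ) ⁻¹' Kfᶜ =
      ⋃ k, (fun γ : YangBaxterSAW Θ D.carrier δ (a δ) (b δ) => γ.curve Θ δ) ⁻¹' (A k)ᶜ := by
    simp only [hKf, Set.compl_iInter, Set.preimage_iUnion]
  rw [hpre]
  refine (measure_iUnion_le _).trans ?_
  have hbound : ∀ k, ybLaw Θ D.carrier δ 1 (a δ) (b δ)
      ((fun γ : YangBaxterSAW Θ D.carrier δ (a δ) (b δ) => γ.curve Θ δ) ⁻¹' (A k)ᶜ) ≤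
        ENNReal.ofReal (e / 2 / 2 ^ k) := by
    intro k
    rcases lt_or_ge δ (σ (k + 1)) with hlt | hle
    · have hδk : δ ∈ Set.Ioo 0 (τ k) := ⟨hδ.1, hlt.trans_le ((hσanti k).trans (hσle k))⟩
      refine (measure_mono ?_).trans (hKτ k δ hδk).2
      refine Set.preimage_mono (Set.compl_subset_compl.2 ?_)
      exact (Metric.thickening_subset_cthickening _ _).trans Set.subset_union_left
    · have hne : a δ ≠ b δ := ((hKτ 0 δ ⟨hδ.1, hδ.2.trans_le (hσle 0)⟩).1).2
      refine (measure_mono_null (t := ∅) (fun γ hγ => ?_) measure_empty).trans_le bot_le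
      exact (hγ (Or.inr (hCmem k δ ⟨hle, hδ.2.le⟩ _ _ hne γ))).elim
  calc ∑' k, ybLaw Θ D.carrier δ 1 (a δ) (b δ)
          ((fun γ : YangBaxterSAW Θ D.carrier δ (a δ) (b δ) => γ.curve Θ δ) ⁻¹' (A k)ᶜ)
        ≤ ∑' k, ENNReal.ofReal (e / 2 / 2 ^ k) := ENNReal.tsum_le_tsum hbound
    _ = ENNReal.ofReal (∑' k, e / 2 / 2 ^ k) :=
        (ENNReal.ofReal_tsum_of_nonneg (fun k => by positivity) (summable_geometric_two' e)).symm
    _ = ENNReal.ofReal e := by rw [tsum_geometric_two' e]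
    _ = ε := ENNReal.ofReal_toReal hεtop

/-- **Convergence in law to SLE_κ (any `κ`) of GM's `π/2` Yang–Baxter walk forces tightness along the
mesh** — the case `μ = (pre-Wiener).map Γ` of `isTightAlongMesh_yb_of_tendsto` (the SLE law is a
probability measure on the Polish space `CurveClass ℂ`, `isProbabilityMeasure_preWienerMeasure'`,
`IsSLECurve.aemeasurable`, `integral_map`). -/
theorem ybTight_of_convergesInLawToSLE {κ : ℝ≥0} {D : DobrushinDomain} {a b : ℝ → MidEdge}
    (hab : IsYBEndpointApprox (fun (_ : ℤ) => Real.pi / 2) D a b)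
    (h : ConvergesInLawToSLE κ D
      (fun δ (γ : YangBaxterSAW (fun (_ : ℤ) => Real.pi / 2) D.carrier δ (a δ) (b δ)) =>
        γ.curve (fun (_ : ℤ) => Real.pi / 2) δ)
      (fun δ => ybLaw (fun (_ : ℤ) => Real.pi / 2) D.carrier δ 1 (a δ) (b δ))) :
    IsTightAlongMesh
      (fun δ (γ : YangBaxterSAW (fun (_ : ℤ) => Real.pi / 2) D.carrier δ (a δ) (b δ)) =>
        γ.curve (fun (_ : ℤ) => Real.pi / 2) δ)
      (fun δ => ybLaw (fun (_ : ℤ) => Real.pi / 2) D.carrier δ 1 (a δ) (b δ)) := by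
  obtain ⟨Γ, hΓ, -, hT⟩ := h
  haveI := isProbabilityMeasure_preWienerMeasure'
  haveI : IsProbabilityMeasure (Literature.Probability.Process.preWienerMeasure.map Γ) :=
    Measure.isProbabilityMeasure_map hΓ.aemeasurable
  refine isTightAlongMesh_yb_of_tendsto hab
    (μ := Literature.Probability.Process.preWienerMeasure.map Γ) fun f => ?_
  rw [integral_map hΓ.aemeasurable f.continuous.aestronglyMeasurable]
  exact hT f

/-- **Tightness along the mesh ⇒ set-tightness of the pushed laws over an initial mesh interval.**
Choose `δ₀` with `a δ ≠ b δ` on `(0, 2δ₀)` (`eventually_ne_of_isYBEndpointApprox`); given `ε`,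
tightness gives a compact `K_ε` below a threshold `η_ε`, and the container `C` of
`exists_isCompact_forall_ybCurve_mem` for the meshes `[η_ε, δ₀]` carries ALL curve classes there; so
`K_ε ∪ C` carries all but `ε` of every pushed law, `δ ∈ (0, δ₀]` (`Measure.map_apply`,
`YBWalk.measurable_of_top`). -/
theorem exists_isTightMeasureSet_image_yb {D : DobrushinDomain} {a b : ℝ → MidEdge}
    (hab : IsYBEndpointApprox (fun (_ : ℤ) => Real.pi / 2) D a b)
    (hT : IsTightAlongMesh
      (fun δ (γ : YangBaxterSAW (fun (_ : ℤ) => Real.pi / 2) D.carrier δ (a δ) (b δ)) =>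
        γ.curve (fun (_ : ℤ) => Real.pi / 2) δ)
      (fun δ => ybLaw (fun (_ : ℤ) => Real.pi / 2) D.carrier δ 1 (a δ) (b δ))) :
    ∃ δ₀ : ℝ, 0 < δ₀ ∧ IsTightMeasureSet
      ((fun δ => (ybLaw (fun (_ : ℤ) => Real.pi / 2) D.carrier δ 1 (a δ) (b δ)).map
        (fun γ => γ.curve (fun (_ : ℤ) => Real.pi / 2) δ)) '' Set.Ioc 0 δ₀) := by
  set Θ : ℤ → ℝ := fun _ => Real.pi / 2 with hΘ
  obtain ⟨δ₁, hδ₁, hsub₁⟩ :=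
    mem_nhdsGT_iff_exists_Ioo_subset.1 (eventually_ne_of_isYBEndpointApprox hab)
  have hδ₁' : (0 : ℝ) < δ₁ := hδ₁
  refine ⟨δ₁ / 2, half_pos hδ₁', ?_⟩
  rw [isTightMeasureSet_iff_exists_isCompact_measure_compl_le]
  intro ε hε
  obtain ⟨K, hK, hev⟩ := hT ε hε
  obtain ⟨η, hη, hsubη⟩ := mem_nhdsGT_iff_exists_Ioo_subset.1 hev
  have hη' : (0 : ℝ) < η := hη
  -- the container for the meshes above the tightness threshold
  obtain ⟨C, hC, hCmem⟩ :=
    exists_isCompact_forall_ybCurve_mem D.carrier D.isBounded η (δ₁ / 2) hη'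
  refine ⟨K ∪ C, hK.union hC, ?_⟩
  rintro _ ⟨δ, hδ, rfl⟩
  have hne : a δ ≠ b δ := hsub₁ ⟨hδ.1, hδ.2.trans_lt (half_lt_self hδ₁')⟩
  show ((ybLaw Θ D.carrier δ 1 (a δ) (b δ)).map
      (fun γ : YangBaxterSAW Θ D.carrier δ (a δ) (b δ) => γ.curve Θ δ)) (K ∪ C)ᶜ ≤ ε
  rw [Measure.map_apply (YBWalk.measurable_of_top _) (hK.union hC).isClosed.measurableSet.compl]
  rcases lt_or_ge δ η with hlt | hge
  · have hb : ybLaw Θ D.carrier δ 1 (a δ) (b δ)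
        ((fun γ : YangBaxterSAW Θ D.carrier δ (a δ) (b δ) => γ.curve Θ δ) ⁻¹' Kᶜ) ≤ ε :=
      hsubη ⟨hδ.1, hlt⟩
    refine (measure_mono ?_).trans hb
    exact Set.preimage_mono (Set.compl_subset_compl.2 Set.subset_union_left)
  · refine (measure_mono_null (t := ∅) (fun γ hγ => ?_) measure_empty).trans_le bot_le
    exact (hγ (Or.inr (hCmem δ ⟨hge, hδ.2⟩ _ _ hne γ))).elim

/-- **Set-tightness of the pushed curve laws over `δ ∈ (0, δ₀]` gives the Aizenman–Burchard T1 shape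
with `K = 1`, `λ = 3`** (any angle sequence, domain, endpoint functions): for a genuine shell
`0 < ρ < R` take `ε = (ρ/R)^3`, the compact `𝒦_ε` carrying all but `ε` of every pushed law, and the
threshold `k x ρ R` of `exists_forall_not_hasTraversals_of_isCompact`; then
`P_δ(⟨γ.path⟩ traverses D(x; ρ, R) k-fold) ≤ P_δ(curve ∉ 𝒦_ε) ≤ ε` (`Measure.le_map_apply`; the class of
`⟨γ.path Θ δ⟩` is `γ.curve Θ δ` by `rfl`). `δ ≤ ρ`, `R ≤ 1` are not used. Port of
`ShellCrossingBound.Negative.targets_of_isTightMeasureSet`. -/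
theorem ybTraversalBound_of_isTightMeasureSet_image {Θ : ℤ → ℝ} {Ω : Set ℂ} {a b : ℝ → MidEdge}
    (h : ∃ δ₀ : ℝ, 0 < δ₀ ∧ IsTightMeasureSet
      ((fun δ => (ybLaw Θ Ω δ 1 (a δ) (b δ)).map (fun γ => γ.curve Θ δ)) '' Set.Ioc 0 δ₀)) :
    ∃ (k : ℂ → ℝ → ℝ → ℕ) (K lam δ₀ : ℝ), 0 ≤ K ∧ 2 < lam ∧ 0 < δ₀ ∧
      ∀ δ ∈ Set.Ioc (0 : ℝ) δ₀, ∀ (x : ℂ) (ρ R : ℝ), δ ≤ ρ → ρ < R → R ≤ 1 →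
        ybLaw Θ Ω δ 1 (a δ) (b δ)
            {γ | (⟨γ.path Θ δ⟩ : Curve ℂ).HasTraversals (k x ρ R) x ρ R} ≤
          ENNReal.ofReal (K * (ρ / R) ^ lam) := by
  -- adapted from `ShellCrossingBound.Negative.targets_of_isTightMeasureSet`
  obtain ⟨δ₀, hδ₀, htight⟩ := h
  rw [isTightMeasureSet_iff_exists_isCompact_measure_compl_le] at htight
  have key : ∀ (x : ℂ) (ρ R : ℝ), ∃ k : ℕ, 0 < ρ → ρ < R → ∀ δ ∈ Set.Ioc (0 : ℝ) δ₀,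
      ybLaw Θ Ω δ 1 (a δ) (b δ) {γ | (⟨γ.path Θ δ⟩ : Curve ℂ).HasTraversals k x ρ R} ≤
        ENNReal.ofReal (1 * (ρ / R) ^ (3 : ℝ)) := by
    intro x ρ R
    by_cases hρR : 0 < ρ ∧ ρ < R
    · have hpos : 0 < ENNReal.ofReal (1 * (ρ / R) ^ (3 : ℝ)) := by
        rw [one_mul, ENNReal.ofReal_pos]
        exact Real.rpow_pos_of_pos (div_pos hρR.1 (hρR.1.trans hρR.2)) _
      obtain ⟨𝒦, h𝒦, hμ⟩ := htight _ hpos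
      obtain ⟨k, hk⟩ := exists_forall_not_hasTraversals_of_isCompact h𝒦 x hρR.2
      refine ⟨k, fun _ _ δ hδ => ?_⟩
      calc ybLaw Θ Ω δ 1 (a δ) (b δ) {γ | (⟨γ.path Θ δ⟩ : Curve ℂ).HasTraversals k x ρ R}
          ≤ ybLaw Θ Ω δ 1 (a δ) (b δ)
              ((fun γ : YangBaxterSAW Θ Ω δ (a δ) (b δ) => γ.curve Θ δ) ⁻¹' 𝒦ᶜ) := by
            refine measure_mono fun γ hγ => ?_
            exact fun hmem => hk _ hmem hγ
        _ ≤ ((ybLaw Θ Ω δ 1 (a δ) (b δ)).map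
              (fun γ : YangBaxterSAW Θ Ω δ (a δ) (b δ) => γ.curve Θ δ)) 𝒦ᶜ :=
            Measure.le_map_apply (YBWalk.aemeasurable_curve _ _ _ _ _ _) _
        _ ≤ ENNReal.ofReal (1 * (ρ / R) ^ (3 : ℝ)) := hμ _ ⟨δ, hδ, rfl⟩
    · exact ⟨0, fun h1 h2 => absurd ⟨h1, h2⟩ hρR⟩
  choose k hk using key
  refine ⟨k, 1, 3, δ₀, zero_le_one, by norm_num, hδ₀, fun δ hδ x ρ R hδρ hρR _ => ?_⟩
  exact hk x ρ R (hδ.1.trans_le hδρ) hρR δ hδ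

/-! ### The certificates: the crux implies T1 (and T) -/

/-- **Convergence in law to SLE_κ (any `κ`) of GM's `π/2` Yang–Baxter walk in `(D; a_δ, b_δ)` implies
the traversal bound T1 there** (`ybTight_of_convergesInLawToSLE`, `exists_isTightMeasureSet_image_yb`,
`ybTraversalBound_of_isTightMeasureSet_image`). -/
theorem ybTraversalBound_of_convergesInLawToSLE {κ : ℝ≥0} {D : DobrushinDomain} {a b : ℝ → MidEdge}
    (hab : IsYBEndpointApprox (fun (_ : ℤ) => Real.pi / 2) D a b)
    (h : ConvergesInLawToSLE κ D
      (fun δ (γ : YangBaxterSAW (fun (_ : ℤ) => Real.pi / 2) D.carrier δ (a δ) (b δ)) =>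
        γ.curve (fun (_ : ℤ) => Real.pi / 2) δ)
      (fun δ => ybLaw (fun (_ : ℤ) => Real.pi / 2) D.carrier δ 1 (a δ) (b δ))) :
    ∃ (k : ℂ → ℝ → ℝ → ℕ) (K lam δ₀ : ℝ), 0 ≤ K ∧ 2 < lam ∧ 0 < δ₀ ∧
      ∀ δ ∈ Set.Ioc (0 : ℝ) δ₀, ∀ (x : ℂ) (ρ R : ℝ), δ ≤ ρ → ρ < R → R ≤ 1 →
        ybLaw (fun (_ : ℤ) => Real.pi / 2) D.carrier δ 1 (a δ) (b δ)
            {γ | (⟨γ.path (fun (_ : ℤ) => Real.pi / 2) δ⟩ : Curve ℂ).HasTraversals (k x ρ R) x ρ R} ≤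
          ENNReal.ofReal (K * (ρ / R) ^ lam) :=
  ybTraversalBound_of_isTightMeasureSet_image
    (exists_isTightMeasureSet_image_yb hab (ybTight_of_convergesInLawToSLE hab h))

/-- **`YBSquareSLE` forces stub T1** (`stub_ybTraversalBound` of the registered skeleton is
necessary): the conclusion is the registered signature of `stub_ybTraversalBound`, verbatim. So the
reshaped skeleton's T-half is an honest equivalence split (T1 ⇔ T ⇔ T-half of the crux). Registered
sub-goal stub `ybTraversalBound_of_ybSquareSLE`. -/
theorem ybTraversalBound_of_ybSquareSLE :
    SAWCompassLattice.YBSquareSLE →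
    ∀ (D : DobrushinDomain) (a b : ℝ → MidEdge),
      IsYBEndpointApprox (fun (_ : ℤ) => Real.pi / 2) D a b →
      ∃ (k : ℂ → ℝ → ℝ → ℕ) (K lam δ₀ : ℝ), 0 ≤ K ∧ 2 < lam ∧ 0 < δ₀ ∧
        ∀ δ ∈ Set.Ioc (0 : ℝ) δ₀, ∀ (x : ℂ) (ρ R : ℝ), δ ≤ ρ → ρ < R → R ≤ 1 →
          ybLaw (fun (_ : ℤ) => Real.pi / 2) D.carrier δ 1 (a δ) (b δ)
              {γ | (⟨γ.path (fun (_ : ℤ) => Real.pi / 2) δ⟩ : Curve ℂ).HasTraversals (k x ρ R) x ρ R} ≤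
            ENNReal.ofReal (K * (ρ / R) ^ lam) :=
  fun hY D a b hab => ybTraversalBound_of_convergesInLawToSLE hab (hY D a b hab)

/-- **`YBSquareSLE` forces tightness along the mesh** (v1's stub T of the skeleton is necessary):
Le Cam along the mesh (`ybTight_of_convergesInLawToSLE`). Registered sub-goal stub
`ybTight_of_ybSquareSLE`. -/
theorem ybTight_of_ybSquareSLE :
    SAWCompassLattice.YBSquareSLE →
    ∀ (D : DobrushinDomain) (a b : ℝ → MidEdge),
      IsYBEndpointApprox (fun (_ : ℤ) => Real.pi / 2) D a b →
      IsTightAlongMesh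
        (fun δ (γ : YangBaxterSAW (fun (_ : ℤ) => Real.pi / 2) D.carrier δ (a δ) (b δ)) =>
          γ.curve (fun (_ : ℤ) => Real.pi / 2) δ)
        (fun δ => ybLaw (fun (_ : ℤ) => Real.pi / 2) D.carrier δ 1 (a δ) (b δ)) :=
  fun hY D a b hab => ybTight_of_convergesInLawToSLE hab (hY D a b hab)

end Summit.CriticalPhenomena.SAWScalingLimit.Theorems.SAWCompassLatticeCompassSLE

end
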